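import Mathlib.LinearAlgebra.BilinearForm.Orthogonal
import HarnessLib

/-!
# Crux C1 `MainConjectureTransportAlignedAtTwo` (stmt-BirchSwinnertonDyer-22296), line `birth`, residual (R2) `stub_lamLawKilford` (Kilford stratum):
# the carrier row «`θ` kills `U^⊥`» from Hecke-self-adjointness — `(V[S])^⊥ = Σ_{s ∈ S} s(V)` for a family `S` of `B`-self-adjoint operators
# (width seat att-p4 g17; `--supports 22296`; pure linear algebra)

THEOREMS ONLY (no `def`, no `sorry`, no named fact). BSD is not proved by this; C1 is not closed by this.

The kernel-letter consumer (`…KilfordKernelLetterOnPoints.ker_iff_ker_of_alignedAtTwo`, p690985) asks, for `U = J₀(N)[𝔪_f]`, that the parametrisation on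
`2`-torsion `θ_D` kill `U^⊥ = {w | ∀ u ∈ U, B u w = 0}`. Over any field: if `U` is the common kernel `V[S]` of a family `S` of `B`-SELF-ADJOINT endomorphisms
(`B` nondegenerate and reflexive, `V` finite-dimensional), then `U^⊥ = ⨆_{s ∈ S} range s` (`orthogonal_commonKer_eq`), so ANY linear map killing every
`s(V)`, `s ∈ S`, kills `U^⊥` (**`map_eq_zero_of_orthogonal_commonKer`**). In the model: `S` = the image of `𝔪_f` in `End(J₀(N)[2])` (self-adjoint for the
twisted Weil pairing, (W3)), `U = J₀(N)[𝔪_f]`, and `θ_D ∘ t = 0` for `t ∈ 𝔪_f` is `…KilfordKernelLetterHecke.jacobiMap_half_smul_eq_zero_of_mem_modTwoHeckeIdeal`.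

References (for the reading): B. H. Gross, Duke Math. J. 61 (1990) p. 485 [Gross1990]; L. J. P. Kilford, G. Wiese (2008) Prop. 2.1 [KilfordWiese2008].
-/

set_option autoImplicit false

-- justification: the `Summit.BirchSwinnertonDyer.BirchSwinnertonDyer.…` path repeats a component (route-file convention)
set_option linter.dupNamespace false

namespace Summit.BirchSwinnertonDyer.BirchSwinnertonDyer.Theorems.AlignedTransportAtTwoKilfordKernelLetterOrthogonal

variable {K : Type*} [Field K] {V : Type*} [AddCommGroup V] [Module K V] {W : Type*} [AddCommGroup W] [Module K W]

/-- **The common kernel of a self-adjoint family is the orthogonal of the sum of its images**: for `B` right-separating and `S` a family of `B`-self-adjoint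
endomorphisms, `{v | ∀ s ∈ S, s v = 0} = (⨆_{s ∈ S} range s)^⊥`. [folklore] -/
theorem commonKer_eq_orthogonal_iSup_range (B : LinearMap.BilinForm K V) (hB : B.Nondegenerate)
    (S : Set (V →ₗ[K] V)) (hS : ∀ s ∈ S, ∀ x y, B (s x) y = B x (s y))
    (U : Submodule K V) (hU : ∀ v, v ∈ U ↔ ∀ s ∈ S, s v = 0) :
    U = B.orthogonal (⨆ s : S, LinearMap.range (s : V →ₗ[K] V)) := by
  ext v
  rw [hU, LinearMap.BilinForm.mem_orthogonal_iff]
  constructor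
  · intro hv n hn
    -- `n ↦ B n v` kills every `range s`, hence the sup
    have hle : (⨆ s : S, LinearMap.range (s : V →ₗ[K] V)) ≤ LinearMap.ker (B.flip v) := by
      refine iSup_le fun s => ?_
      rintro _ ⟨x, rfl⟩
      rw [LinearMap.mem_ker, LinearMap.BilinForm.flip_apply, hS s s.2, hv s s.2, map_zero]
    have := hle hn
    rwa [LinearMap.mem_ker, LinearMap.BilinForm.flip_apply] at this
  · intro hv s hs
    refine hB.2 _ fun x => ?_
    rw [← hS s hs]
    exact hv _ (Submodule.mem_iSup_of_mem ⟨s, hs⟩ ⟨x, rfl⟩)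

/-- **`(V[S])^⊥ = ⨆_{s ∈ S} range s`** (`B` nondegenerate reflexive, `V` finite-dimensional). [folklore] -/
theorem orthogonal_commonKer_eq [FiniteDimensional K V] (B : LinearMap.BilinForm K V) (hB : B.Nondegenerate) (hB₀ : B.IsRefl)
    (S : Set (V →ₗ[K] V)) (hS : ∀ s ∈ S, ∀ x y, B (s x) y = B x (s y))
    (U : Submodule K V) (hU : ∀ v, v ∈ U ↔ ∀ s ∈ S, s v = 0) :
    B.orthogonal U = ⨆ s : S, LinearMap.range (s : V →ₗ[K] V) := by
  rw [commonKer_eq_orthogonal_iSup_range B hB S hS U hU, LinearMap.BilinForm.orthogonal_orthogonal hB hB₀]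

/-- **A linear map killing every `s(V)`, `s ∈ S`, kills `(V[S])^⊥`** — the carrier row «`θ` kills `U^⊥`» of the kernel-letter consumer from
Hecke-self-adjointness (W3) and `θ ∘ s = 0` (`…KilfordKernelLetterHecke`). [folklore] -/
theorem map_eq_zero_of_orthogonal_commonKer [FiniteDimensional K V] (B : LinearMap.BilinForm K V) (hB : B.Nondegenerate)
    (hB₀ : B.IsRefl) (S : Set (V →ₗ[K] V)) (hS : ∀ s ∈ S, ∀ x y, B (s x) y = B x (s y))
    (U : Submodule K V) (hU : ∀ v, v ∈ U ↔ ∀ s ∈ S, s v = 0)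
    (θ : V →ₗ[K] W) (hθ : ∀ s ∈ S, ∀ v, θ (s v) = 0) :
    ∀ w, (∀ u ∈ U, B u w = 0) → θ w = 0 := by
  intro w hw
  have hmem : w ∈ B.orthogonal U := (LinearMap.BilinForm.mem_orthogonal_iff).mpr hw
  rw [orthogonal_commonKer_eq B hB hB₀ S hS U hU] at hmem
  have hle : (⨆ s : S, LinearMap.range (s : V →ₗ[K] V)) ≤ LinearMap.ker θ := by
    refine iSup_le fun s => ?_
    rintro _ ⟨x, rfl⟩
    exact hθ s s.2 x
  exact hle hmem

/-- Symmetric forms are reflexive (bookkeeping for the consumer, which carries `hBsymm`). [folklore] -/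
theorem isRefl_of_symm (B : LinearMap.BilinForm K V) (hBsymm : ∀ x y, B x y = B y x) : B.IsRefl :=
  fun x y h => by rw [hBsymm]; exact h

end Summit.BirchSwinnertonDyer.BirchSwinnertonDyer.Theorems.AlignedTransportAtTwoKilfordKernelLetterOrthogonal
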